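import Literature.NumberTheory.EllipticCurves.Gamma0AwayTreeCoordinates
import HarnessLib

/-!
# The four ping-pong moves of `Γ₀(L′)` and `θΓ₀(L′)` on `SL₂(ℤ[1/t])`
# (the half-trees of the Bruhat–Tits tree cut out by the edge `v₀v₁`, in coordinates)

Topic `Literature/NumberTheory/EllipticCurves` (supporting the named fact
`gamma0Away_character_extension_of_shiftInvariant` of `Gamma0AwayCharacterExtension.lean`; sub-namespace
`Gamma0Away`; continues `Gamma0AwayTreeCoordinates.lean`).  Theorems only.  With `ι : SL₂(ℤ) → SL₂(ℤ[1/t])`,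
`θ = Ad(diag(t,1)⁻¹)`, the half-tree predicate `TopHeavy` ("`X₁`") and the `height` of that file:

* (h0) `not_topHeavy_map`, `height_map`: an integral matrix is not top-heavy and has height `1`
  (`SL₂(ℤ)` fixes the root `v₀`);
* (hL) `not_topHeavy_map_mul`: `γ ∈ SL₂(ℤ)` with `t ∤ γ₁₀` (i.e. `γ ∈ Γ₀(L′) ∖ Γ₀(L′t)`) maps `X₁` out of
  `X₁`, preserving the height;
* (hR) `topHeavy_theta_map_mul`: `θ(ιγ)` with `t ∤ γ₀₁` (i.e. `θ(ιγ) ∈ θΓ₀(L′) ∖ Γ₀(L′t)`) maps the complement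
  of `X₁` into `X₁`, multiplying the height by `t`;
* (hB) `topHeavy_map_mul_iff`: `γ` with `t ∣ γ₁₀` (`Γ₀(L′t)`, the stabiliser of the edge `v₀v₁`) preserves
  `X₁` and the height.

These are exactly the hypotheses of the abstract ping-pong criterion
`Literature.GroupTheory.CombinatorialGroupTheory.Amalgam.exists_extension_of_pingPong` for the amalgam
`Γ₀(L′) *_{Γ₀(L′t)} Γ₀(L′) → SL₂(ℤ[1/t])`, `(γ, γ′) ↦ ιγ · θ(ιγ′)` (Serre, *Trees* II §1.4 Thm. 3 and its
Cor. 1 for the level structure).  Each is a two-line ultrametric estimate with the row lemma.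

## References

* J.-P. Serre, *Trees*, Springer (1980), Ch. II §1.1, §1.4 (Ihara's theorem). [SerreTrees1980]
-/

noncomputable section

open scoped MatrixGroups

namespace Literature.NumberTheory.EllipticCurves

namespace Gamma0Away

open Automorphic

variable (t : ℕ) [Fact t.Prime]

/-! ### Sizes of integral matrices and of their shifts -/

omit [Fact t.Prime] in
/-- Entries of `ι γ`, `ι : SL₂(ℤ) → SL₂(ℤ[1/t])`, are the integer entries of `γ`. [cite: SerreTrees1980, Ch. II §1.4] -/
theorem map_apply_int (γ : SL(2, ℤ)) (i j : Fin 2) :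
    (Matrix.SpecialLinearGroup.map (Int.castRingHom (Localization.Away (t : ℤ))) γ) i j =
      ((γ i j : ℤ) : Localization.Away (t : ℤ)) := by
  simp [Matrix.SpecialLinearGroup.map_apply_coe]

/-- An integral matrix has top row of size `≤ 1`. [cite: SerreTrees1980, Ch. II §1.1] -/
theorem topSize_map_le_one (γ : SL(2, ℤ)) :
    topSize t (Matrix.SpecialLinearGroup.map (Int.castRingHom (Localization.Away (t : ℤ))) γ) ≤ 1 := by
  simp only [topSize, map_apply_int]
  exact max_le (tsize_intCast_le_one t _) (tsize_intCast_le_one t _)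

/-- An integral matrix of determinant `1` has bottom row of size exactly `1` (its bottom row is
primitive). [cite: SerreTrees1980, Ch. II §1.1] -/
theorem botSize_map_eq_one (γ : SL(2, ℤ)) :
    botSize t (Matrix.SpecialLinearGroup.map (Int.castRingHom (Localization.Away (t : ℤ))) γ) = 1 := by
  simp only [botSize, map_apply_int]
  have hdet : γ 0 0 * γ 1 1 - γ 0 1 * γ 1 0 = 1 := by
    have := Matrix.det_fin_two (γ : Matrix (Fin 2) (Fin 2) ℤ)
    rw [γ.det_coe] at this
    exact this.symm
  by_cases hc : (t : ℤ) ∣ γ 1 0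
  · have hd : ¬ (t : ℤ) ∣ γ 1 1 := by
      intro hd
      have h1 : (t : ℤ) ∣ 1 := by
        rw [← hdet]
        exact dvd_sub (dvd_mul_of_dvd_right hd _) (dvd_mul_of_dvd_right hc _)
      exact (Fact.out : t.Prime).ne_one (by exact_mod_cast Int.eq_one_of_dvd_one (by positivity) h1)
    rw [max_eq_right ((tsize_intCast_le_one t _).trans ((tsize_intCast_eq_one_iff t _).2 hd).ge),
      (tsize_intCast_eq_one_iff t _).2 hd]
  · rw [max_eq_left ((tsize_intCast_le_one t _).trans ((tsize_intCast_eq_one_iff t _).2 hc).ge),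
      (tsize_intCast_eq_one_iff t _).2 hc]

/-- An integral matrix is not top-heavy (it fixes the root `v₀`). [cite: SerreTrees1980, Ch. II §1.1] -/
theorem not_topHeavy_map (γ : SL(2, ℤ)) :
    ¬ TopHeavy t (Matrix.SpecialLinearGroup.map (Int.castRingHom (Localization.Away (t : ℤ))) γ) := by
  rw [TopHeavy, botSize_map_eq_one, not_lt]
  exact topSize_map_le_one t γ

/-- An integral matrix has height `1` (`= height 1`: it fixes the root `v₀`). [cite: SerreTrees1980, Ch. II §1.1] -/
theorem height_map (γ : SL(2, ℤ)) :
    height t (Matrix.SpecialLinearGroup.map (Int.castRingHom (Localization.Away (t : ℤ))) γ) = 1 := by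
  rw [height, botSize_map_eq_one, max_eq_right (topSize_map_le_one t γ)]

/-- `height 1 = 1`. [cite: SerreTrees1980, Ch. II §1.1] -/
theorem height_one : height t (1 : SL(2, Localization.Away (t : ℤ))) = 1 := by
  have := height_map t 1
  rwa [map_one] at this

/-- `topSize`, `botSize` are nonnegative; `height = topSize` on top-heavy elements, `= botSize` otherwise
(plumbing). [cite: SerreTrees1980, Ch. II §1.1] -/
theorem height_eq_topSize_of_topHeavy {g : SL(2, Localization.Away (t : ℤ))} (h : TopHeavy t g) :
    height t g = topSize t g := max_eq_left (le_of_lt h)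

/-- `height = botSize` off the top-heavy set (plumbing). [cite: SerreTrees1980, Ch. II §1.1] -/
theorem height_eq_botSize_of_not_topHeavy {g : SL(2, Localization.Away (t : ℤ))} (h : ¬ TopHeavy t g) :
    height t g = botSize t g := max_eq_right (not_lt.1 h)

/-! ### The four ping-pong moves -/

/-- **(hL) A matrix of `Γ₀(L′) ∖ Γ₀(L′t)` maps the half-tree `X₁` out of itself, preserving the height**:
for `γ ∈ SL₂(ℤ)` with `t ∤ γ₁₀` and `h` top-heavy, `ιγ · h` is not top-heavy and has the height of `h`
(`γ` fixes `v₀` and moves the edge `v₀v₁`). [cite: SerreTrees1980, Ch. II §1.4] -/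
theorem not_topHeavy_map_mul (γ : SL(2, ℤ)) (hγ : ¬ (t : ℤ) ∣ γ 1 0)
    {h : SL(2, Localization.Away (t : ℤ))} (hh : TopHeavy t h) :
    ¬ TopHeavy t (Matrix.SpecialLinearGroup.map (Int.castRingHom (Localization.Away (t : ℤ))) γ * h) ∧
      height t (Matrix.SpecialLinearGroup.map (Int.castRingHom (Localization.Away (t : ℤ))) γ * h) =
        height t h := by
  set g := Matrix.SpecialLinearGroup.map (Int.castRingHom (Localization.Away (t : ℤ))) γ with hg
  have hT := topSize_pos t h
  have hB0 : 0 ≤ botSize t h := (botSize_pos t h).le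
  have hh' : botSize t h < topSize t h := hh
  have h10 : tsize t (g 1 0) = 1 := by rw [hg, map_apply_int]; exact (tsize_intCast_eq_one_iff t _).2 hγ
  have h11 : tsize t (g 1 1) ≤ 1 := by rw [hg, map_apply_int]; exact tsize_intCast_le_one t _
  have h00 : tsize t (g 0 0) ≤ 1 := by rw [hg, map_apply_int]; exact tsize_intCast_le_one t _
  have h01 : tsize t (g 0 1) ≤ 1 := by rw [hg, map_apply_int]; exact tsize_intCast_le_one t _
  have hbot : botSize t (g * h) = topSize t h := by
    rw [botSize_mul_eq_left t g h, h10, one_mul]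
    rw [h10, one_mul]
    calc tsize t (g 1 1) * botSize t h ≤ 1 * botSize t h := mul_le_mul_of_nonneg_right h11 hB0
      _ = botSize t h := one_mul _
      _ < topSize t h := hh'
  have htop : topSize t (g * h) ≤ topSize t h := by
    refine (topSize_mul_le t g h).trans (max_le ?_ ?_)
    · calc tsize t (g 0 0) * topSize t h ≤ 1 * topSize t h := mul_le_mul_of_nonneg_right h00 hT.le
        _ = topSize t h := one_mul _
    · calc tsize t (g 0 1) * botSize t h ≤ 1 * botSize t h := mul_le_mul_of_nonneg_right h01 hB0
        _ = botSize t h := one_mul _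
        _ ≤ topSize t h := hh'.le
  have hnot : ¬ TopHeavy t (g * h) := by
    rw [TopHeavy, hbot, not_lt]; exact htop
  refine ⟨hnot, ?_⟩
  rw [height_eq_botSize_of_not_topHeavy t hnot, hbot, height_eq_topSize_of_topHeavy t hh]

/-- **(hR) A matrix of `θΓ₀(L′) ∖ Γ₀(L′t)` maps the complement of `X₁` into `X₁`, raising the height**:
for `γ ∈ SL₂(ℤ)` with `t ∤ γ₀₁` and `h` not top-heavy, `θ(ιγ) · h` is top-heavy and of height `t · height h`
(`θ(ιγ)` fixes `v₁` and moves the edge `v₁v₀`). [cite: SerreTrees1980, Ch. II §1.4] -/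
theorem topHeavy_theta_map_mul (γ : SL(2, ℤ)) (hγ : ¬ (t : ℤ) ∣ γ 0 1)
    {h : SL(2, Localization.Away (t : ℤ))} (hh : ¬ TopHeavy t h) :
    TopHeavy t (theta t (Matrix.SpecialLinearGroup.map (Int.castRingHom (Localization.Away (t : ℤ))) γ) * h) ∧
      height t h <
        height t (theta t (Matrix.SpecialLinearGroup.map (Int.castRingHom (Localization.Away (t : ℤ))) γ) * h) := by
  set g := theta t (Matrix.SpecialLinearGroup.map (Int.castRingHom (Localization.Away (t : ℤ))) γ) with hg
  have ht1 := one_lt_natCast t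
  have hT := topSize_pos t h
  have hB := botSize_pos t h
  have hh' : topSize t h ≤ botSize t h := not_lt.1 hh
  have h00 : tsize t (g 0 0) ≤ 1 := by
    rw [hg, theta_apply, thetaAux_apply_00, map_apply_int]; exact tsize_intCast_le_one t _
  have h01 : tsize t (g 0 1) = t := by
    rw [hg, theta_apply, thetaAux_apply_01, map_apply_int, tsize_mul, tsize_invSelf,
      (tsize_intCast_eq_one_iff t _).2 hγ, one_mul]
  have h10 : tsize t (g 1 0) ≤ (t : ℚ)⁻¹ := by
    rw [hg, theta_apply, thetaAux_apply_10, map_apply_int, tsize_mul, tsize_natCast_self]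
    calc (t : ℚ)⁻¹ * tsize t _ ≤ (t : ℚ)⁻¹ * 1 :=
          mul_le_mul_of_nonneg_left (tsize_intCast_le_one t _) (inv_nonneg.2 (by positivity))
      _ = (t : ℚ)⁻¹ := mul_one _
  have h11 : tsize t (g 1 1) ≤ 1 := by
    rw [hg, theta_apply, thetaAux_apply_11, map_apply_int]; exact tsize_intCast_le_one t _
  have htop : topSize t (g * h) = t * botSize t h := by
    rw [topSize_mul_eq_right t g h, h01]
    rw [h01]
    calc tsize t (g 0 0) * topSize t h ≤ 1 * topSize t h := mul_le_mul_of_nonneg_right h00 hT.le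
      _ = topSize t h := one_mul _
      _ ≤ botSize t h := hh'
      _ = 1 * botSize t h := (one_mul _).symm
      _ < t * botSize t h := mul_lt_mul_of_pos_right ht1 hB
  have hbot : botSize t (g * h) ≤ botSize t h := by
    refine (botSize_mul_le t g h).trans (max_le ?_ ?_)
    · calc tsize t (g 1 0) * topSize t h ≤ (t : ℚ)⁻¹ * topSize t h := mul_le_mul_of_nonneg_right h10 hT.le
        _ ≤ 1 * topSize t h :=
          mul_le_mul_of_nonneg_right (inv_le_one_of_one_le₀ ht1.le) hT.le
        _ = topSize t h := one_mul _
        _ ≤ botSize t h := hh'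
    · calc tsize t (g 1 1) * botSize t h ≤ 1 * botSize t h := mul_le_mul_of_nonneg_right h11 hB.le
        _ = botSize t h := one_mul _
  have hlt : botSize t h < t * botSize t h := by
    calc botSize t h = 1 * botSize t h := (one_mul _).symm
      _ < t * botSize t h := mul_lt_mul_of_pos_right ht1 hB
  have hth : TopHeavy t (g * h) := by
    rw [TopHeavy, htop]; exact lt_of_le_of_lt hbot hlt
  refine ⟨hth, ?_⟩
  rw [height_eq_topSize_of_topHeavy t hth, htop, height_eq_botSize_of_not_topHeavy t hh]
  exact hlt

/-- **(hB) A matrix of `Γ₀(L′t)` (indeed any `γ ∈ SL₂(ℤ)` with `t ∣ γ₁₀`) preserves the half-tree `X₁` and the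
height** (it fixes the edge `v₀v₁`). [cite: SerreTrees1980, Ch. II §1.4] -/
theorem topHeavy_map_mul_iff (γ : SL(2, ℤ)) (hγ : (t : ℤ) ∣ γ 1 0) (h : SL(2, Localization.Away (t : ℤ))) :
    (TopHeavy t (Matrix.SpecialLinearGroup.map (Int.castRingHom (Localization.Away (t : ℤ))) γ * h) ↔
        TopHeavy t h) ∧
      height t (Matrix.SpecialLinearGroup.map (Int.castRingHom (Localization.Away (t : ℤ))) γ * h) =
        height t h := by
  set g := Matrix.SpecialLinearGroup.map (Int.castRingHom (Localization.Away (t : ℤ))) γ with hg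
  have ht1 := one_lt_natCast t
  have hT := topSize_pos t h
  have hB := botSize_pos t h
  have hdet : γ 0 0 * γ 1 1 - γ 0 1 * γ 1 0 = 1 := by
    have := Matrix.det_fin_two (γ : Matrix (Fin 2) (Fin 2) ℤ)
    rw [γ.det_coe] at this
    exact this.symm
  have hγ00 : ¬ (t : ℤ) ∣ γ 0 0 := by
    intro hd
    have h1 : (t : ℤ) ∣ 1 := by
      rw [← hdet]; exact dvd_sub (dvd_mul_of_dvd_left hd _) (dvd_mul_of_dvd_right hγ _)
    exact (Fact.out : t.Prime).ne_one (by exact_mod_cast Int.eq_one_of_dvd_one (by positivity) h1)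
  have hγ11 : ¬ (t : ℤ) ∣ γ 1 1 := by
    intro hd
    have h1 : (t : ℤ) ∣ 1 := by
      rw [← hdet]; exact dvd_sub (dvd_mul_of_dvd_right hd _) (dvd_mul_of_dvd_right hγ _)
    exact (Fact.out : t.Prime).ne_one (by exact_mod_cast Int.eq_one_of_dvd_one (by positivity) h1)
  have h00 : tsize t (g 0 0) = 1 := by rw [hg, map_apply_int]; exact (tsize_intCast_eq_one_iff t _).2 hγ00
  have h11 : tsize t (g 1 1) = 1 := by rw [hg, map_apply_int]; exact (tsize_intCast_eq_one_iff t _).2 hγ11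
  have h01 : tsize t (g 0 1) ≤ 1 := by rw [hg, map_apply_int]; exact tsize_intCast_le_one t _
  have h10 : tsize t (g 1 0) ≤ (t : ℚ)⁻¹ := by
    rw [hg, map_apply_int]
    have := (padicNorm.dvd_iff_norm_le (p := t) (n := 1) (z := γ 1 0)).1 (by simpa using hγ)
    simpa [tsize, toRat_intCast] using this
  have h10' : tsize t (g 1 0) * topSize t h < topSize t h := by
    calc tsize t (g 1 0) * topSize t h ≤ (t : ℚ)⁻¹ * topSize t h := mul_le_mul_of_nonneg_right h10 hT.le
      _ < 1 * topSize t h := mul_lt_mul_of_pos_right (inv_lt_one_of_one_lt₀ ht1) hT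
      _ = topSize t h := one_mul _
  by_cases hh : TopHeavy t h
  · have hh' : botSize t h < topSize t h := hh
    have htop : topSize t (g * h) = topSize t h := by
      rw [topSize_mul_eq_left t g h, h00, one_mul]
      rw [h00, one_mul]
      calc tsize t (g 0 1) * botSize t h ≤ 1 * botSize t h := mul_le_mul_of_nonneg_right h01 hB.le
        _ = botSize t h := one_mul _
        _ < topSize t h := hh'
    have hbot : botSize t (g * h) < topSize t h := by
      refine lt_of_le_of_lt (botSize_mul_le t g h) (max_lt h10' ?_)
      rw [h11, one_mul]; exact hh'
    have hth : TopHeavy t (g * h) := by rw [TopHeavy, htop]; exact hbot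
    refine ⟨iff_of_true hth hh, ?_⟩
    rw [height_eq_topSize_of_topHeavy t hth, htop, height_eq_topSize_of_topHeavy t hh]
  · have hh' : topSize t h ≤ botSize t h := not_lt.1 hh
    have hbot : botSize t (g * h) = botSize t h := by
      rw [botSize_mul_eq_right t g h, h11, one_mul]
      rw [h11, one_mul]
      exact lt_of_lt_of_le h10' hh'
    have htop : topSize t (g * h) ≤ botSize t h := by
      refine (topSize_mul_le t g h).trans (max_le ?_ ?_)
      · rw [h00, one_mul]; exact hh'
      · calc tsize t (g 0 1) * botSize t h ≤ 1 * botSize t h := mul_le_mul_of_nonneg_right h01 hB.le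
          _ = botSize t h := one_mul _
    have hnot : ¬ TopHeavy t (g * h) := by rw [TopHeavy, hbot, not_lt]; exact htop
    refine ⟨iff_of_false hnot hh, ?_⟩
    rw [height_eq_botSize_of_not_topHeavy t hnot, hbot, height_eq_botSize_of_not_topHeavy t hh]

end Gamma0Away

end Literature.NumberTheory.EllipticCurves

end
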